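import Mathlib
import Summits.ResolutionOfSingularities.ResolutionOfSingularities.Theorems.RadicialJungCleanModelsCleanPatchingDefs
import Summits.ResolutionOfSingularities.ResolutionOfSingularities.Theorems.RadicialJungCleanModelsCleanPatchingStepTwo
import Summits.ResolutionOfSingularities.ResolutionOfSingularities.Theorems.RadicialJungCleanModelsCleanPatchingStep5
import Summits.ResolutionOfSingularities.ResolutionOfSingularities.Theorems.RadicialJungCleanModelsCleanPatchingBadCurveStep
import Literature.AlgebraicGeometry.Resolution.BadCurveInduction
import HarnessLib

/-!
# Route `RadicialJung`, crux `CleanModels` (stmt-ResolutionOfSingularities-15917), line `Sketch` rev 14: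
# stub 4b `stub_cleanTwoModelPatching3` — two-model patching for `P_clean` in transcendence degree 3 (open form)

Kernel transfer, part 5 (last): the `P_clean` twins of `ProjModel.exists_regLe_pair_over` (Zariski's bad-curve
induction) and `ProjModel.twoModelPatching_of_principalization` (Piltant 2013, Prop. 5.1) of
`Literature/AlgebraicGeometry/Resolution/BadCurveInduction.lean`, and the registered stub BY NAME.

Given opens `U₁ ⊆ M₁`, `U₂ ⊆ M₂` of clean-regular points (for the `K^p`-line of `g₀`, `ModelCleanRegAt`) of two
projective models of `K/k` (`trdeg_k K = 3`, `char k = p`), and assuming the hypothesis `hT4` (Piltant's Axiom 4 for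
`P_clean` = Cossart–Piltant Prop. 4.4 KEEPING cleanness on everywhere-clean regular excellent threefolds — the research
stub 4e `stub_cleanPrincipalization3`), some projective model `N → M₁, M₂` is clean-regular over `U₁` and over `U₂`:
Step 2 over `U₂` (`exists_hom_cleanLe_isIso_hasCentre`) gives `N₀ → M₁, M₂` clean-regular over `U₂`; then strong
induction on the `P`-independent measure `badMeasure M₁ U₁ N₀` (iterated quadratic transforms without centre of the
local rings of the bad points), the step `exists_cleanStep` (the measure drops) and the base case Step 5
(`exists_cleanLe_pair_of_closure_subset`, no bad point) — verbatim the structure of the `P_reg` proof, with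
«regular over `Reg`» replaced by «clean-regular over the given opens».  Empty `U₁` is trivial (take `N₀`); empty
`U₂` is absorbed by Step 2 (which then returns `M₂` itself).

* `exists_cleanLe_pair_over` — the bad-curve induction for `P_clean`;
* `cleanTwoModelPatching` — Piltant's Prop. 5.1 for `P_clean`, open form;
* `stub_cleanTwoModelPatching3` — the registered stub (Sketch rev 14, 4b), by name.

All PROVED modulo the hypothesis `hT4` (carried by the stub's signature); nothing here proves resolution in
characteristic `p` or any case of `CleanModels`.
-/

noncomputable section

set_option linter.dupNamespace false -- mandated namespace of this single-conjunct summit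

open CategoryTheory CategoryTheory.Limits AlgebraicGeometry TopologicalSpace IsLocalRing Order
open Literature.AlgebraicGeometry.Resolution Literature.AlgebraicGeometry.Motives
open Literature.AlgebraicGeometry.Resolution.ProjModel

namespace Summit.ResolutionOfSingularities.ResolutionOfSingularities.Theorems.RadicialJung.CleanModels

variable {p : ℕ} {k K : Type} [Field k] [Field K] [Algebra k K]

/-- **Zariski's bad-curve induction for `P_clean`** (twin of `ProjModel.exists_regLe_pair_over`; Piltant 2013, proof of
Prop. 5.1, Steps 3–5, the factorizability Lemma 5.3 replaced by the base-tree count): for a morphism of projective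
models `η : B → A` of a function field of transcendence degree three, a non-empty open `U ⊆ A` of clean-regular points
and an open `U_B ⊆ B` of clean-regular points, assuming `hT4` there is a projective model `Y` with morphisms
`ψ_A : Y → A`, `ψ_B : Y → B` such that `Y` is clean-regular over `U` and over `U_B`.
[cite: Piltant2013, Prop. 5.1 (proof, Steps 3–5), Lemma 5.6] -/
theorem exists_cleanLe_pair_over
    (hT4 : ∀ (p : ℕ), p.Prime → ∀ (S : Scheme.{0}) [IsIntegral S] [IsNoetherian S],
      CharP S.functionField p → Scheme.IsRegular S → Scheme.IsExcellent S → topologicalKrullDim S = 3 →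
      ∀ G : S.functionField, (∀ s : S, CleanRegAt p (algebraMap (S.presheaf.stalk s) S.functionField) G) →
      ∀ J : S.IdealSheafData, J ≠ ⊥ →
      ∃ (S' : Scheme.{0}) (σ : S' ⟶ S) (_ : IsIntegral S') (_ : IsDominant σ),
      IsRegularCentreBlowupSeq σ J ∧ IsLocallyPrincipal (J.comap σ) ∧
      ∀ s' : S', CleanRegAt p (algebraMap (S'.presheaf.stalk s') S'.functionField) (RatFn.functionFieldMap σ G))
    (hp : p.Prime) [CharP k p] (htr : Algebra.trdeg k K = 3) (g₀ : K) :
    ∀ (n : ℕ) (A B : ProjModel k K) (_ : B.Hom A) (U : A.X.Opens) (UB : B.X.Opens),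
      (∀ a ∈ U, ModelCleanRegAt p g₀ A a) → (U : Set A.X).Nonempty → (∀ b ∈ UB, ModelCleanRegAt p g₀ B b) →
      badMeasure A U B = n →
      ∃ (Y : ProjModel k K) (ψA : Y.Hom A) (ψB : Y.Hom B),
        (∀ y : Y.X, ψA.f y ∈ U → ModelCleanRegAt p g₀ Y y) ∧
        (∀ y : Y.X, ψB.f y ∈ UB → ModelCleanRegAt p g₀ Y y) := by
  intro n
  induction n using Nat.strong_induction_on with
  | _ n ih =>
  intro A B η U UB hU hUne hUB hn
  by_cases hbad : ∃ x, IsBad A B U x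
  · -- a bad point: one step, then the induction hypothesis
    obtain ⟨x, hx⟩ := hbad
    obtain ⟨A', B', ρ, η', θ, hθ, hcleanU', hlt⟩ := exists_cleanStep hT4 hp htr g₀ η hU UB hUB hx
    have hU' : ∀ a' ∈ (ρ.f ⁻¹ᵁ U : A'.X.Opens), ModelCleanRegAt p g₀ A' a' := fun a' ha' => hcleanU' a' ha'
    have hU'ne : ((ρ.f ⁻¹ᵁ U : A'.X.Opens) : Set A'.X).Nonempty := by
      refine ⟨genericPoint A'.X, ?_⟩
      show ρ.f (genericPoint A'.X) ∈ U
      rw [ρ.f_genericPoint]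
      exact A.genericPoint_mem hUne
    have hUB' : ∀ b' ∈ (θ.f ⁻¹ᵁ UB : B'.X.Opens), ModelCleanRegAt p g₀ B' b' := fun b' hb' => hθ b' hb'
    obtain ⟨Y, ψA', ψB', hA', hB'⟩ :=
      ih _ (hn ▸ hlt) A' B' η' (ρ.f ⁻¹ᵁ U) (θ.f ⁻¹ᵁ UB) hU' hU'ne hUB' rfl
    exact ⟨Y, ψA'.comp ρ, ψB'.comp θ, fun y hy => hA' y hy, fun y hy => hB' y hy⟩
  · -- no bad point: Step 5
    push Not at hbad
    exact exists_cleanLe_pair_of_closure_subset hT4 hp htr g₀ A B η U hU hUne UB hUB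
      (closure_inter_subset_of_forall_not_isBad hbad)

/-- **Piltant's Prop. 5.1 for `P_clean`, open form** (twin of `ProjModel.twoModelPatching_of_principalization`): given
opens `U₁ ⊆ M₁`, `U₂ ⊆ M₂` of clean-regular points of two projective models of a function field of transcendence
degree three over a field of characteristic `p`, and assuming `hT4`, some projective model `N → M₁, M₂` is
clean-regular over `U₁` and over `U₂` (Step 2 over `U₂`, then the bad-curve induction over `U₁`).
[cite: Piltant2013, Prop. 5.1; CossartPiltant2019, Prop. 4.6 (proof, Step 3)] -/
theorem cleanTwoModelPatching
    (hT4 : ∀ (p : ℕ), p.Prime → ∀ (S : Scheme.{0}) [IsIntegral S] [IsNoetherian S],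
      CharP S.functionField p → Scheme.IsRegular S → Scheme.IsExcellent S → topologicalKrullDim S = 3 →
      ∀ G : S.functionField, (∀ s : S, CleanRegAt p (algebraMap (S.presheaf.stalk s) S.functionField) G) →
      ∀ J : S.IdealSheafData, J ≠ ⊥ →
      ∃ (S' : Scheme.{0}) (σ : S' ⟶ S) (_ : IsIntegral S') (_ : IsDominant σ),
      IsRegularCentreBlowupSeq σ J ∧ IsLocallyPrincipal (J.comap σ) ∧
      ∀ s' : S', CleanRegAt p (algebraMap (S'.presheaf.stalk s') S'.functionField) (RatFn.functionFieldMap σ G))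
    (hp : p.Prime) [CharP k p] (htr : Algebra.trdeg k K = 3) (g₀ : K) (M₁ M₂ : ProjModel k K)
    (U₁ : M₁.X.Opens) (U₂ : M₂.X.Opens) (h₁ : ∀ x ∈ U₁, ModelCleanRegAt p g₀ M₁ x)
    (h₂ : ∀ x ∈ U₂, ModelCleanRegAt p g₀ M₂ x) :
    ∃ (N : ProjModel k K) (φ₁ : N.Hom M₁) (φ₂ : N.Hom M₂),
      (∀ y : N.X, φ₁.f y ∈ U₁ → ModelCleanRegAt p g₀ N y) ∧
      (∀ y : N.X, φ₂.f y ∈ U₂ → ModelCleanRegAt p g₀ N y) := by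
  -- Step 2: `N₀ = J(N₂, M₁) → M₁`, `N₀ → M₂` clean-regular over `U₂`
  obtain ⟨N₂, ψ, hclean₂, -⟩ := exists_hom_cleanLe_isIso_hasCentre hT4 hp htr g₀ M₁ M₂ U₂ h₂
  by_cases hU₁ : (U₁ : Set M₁.X).Nonempty
  · -- the bad-curve induction over `U₁`
    obtain ⟨Y, ψA, ψB, hA, hB⟩ := exists_cleanLe_pair_over hT4 hp htr g₀ _ M₁ (join N₂ M₁) (joinSnd N₂ M₁) U₁
      (((joinFst N₂ M₁).comp ψ).f ⁻¹ᵁ U₂) h₁ hU₁ (fun b hb => hclean₂ b hb) rfl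
    exact ⟨Y, ψA, ψB.comp ((joinFst N₂ M₁).comp ψ), hA, fun y hy => hB y hy⟩
  · exact ⟨join N₂ M₁, joinSnd N₂ M₁, (joinFst N₂ M₁).comp ψ, fun y hy => absurd ⟨_, hy⟩ hU₁, hclean₂⟩

/-- STUB 4b of `Cruxes/CleanModels/Lines/Sketch.lean` rev 14 (crux stmt-ResolutionOfSingularities-15917), BY NAME:
**two-model patching for `P_clean` in transcendence degree 3, open form** (Piltant 2013, Prop. 5.1 for
`P = P_clean(g₀)`): given opens `Uᵢ ⊆ Mᵢ` of clean-regular points of two projective models of `K/k`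
(`trdeg_k K = 3`), some projective model `N → M₁, M₂` is clean-regular over `U₁` and over `U₂` — assuming `hT4`,
Piltant's Axiom 4 for `P_clean` (Cossart–Piltant Prop. 4.4 keeping cleanness; the research stub 4e).  Proof: the
kernel transfer `cleanTwoModelPatching` of the tree's `P_reg` patching chain. [cite: Piltant2013, Prop. 5.1] -/
theorem stub_cleanTwoModelPatching3
    (hT4 : ∀ (p : ℕ), p.Prime → ∀ (S : Scheme.{0}) [IsIntegral S] [IsNoetherian S],
    CharP S.functionField p → Scheme.IsRegular S → Scheme.IsExcellent S → topologicalKrullDim S = 3 →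
    ∀ G : S.functionField, (∀ s : S, CleanRegAt p (algebraMap (S.presheaf.stalk s) S.functionField) G) →
    ∀ J : S.IdealSheafData, J ≠ ⊥ →
    ∃ (S' : Scheme.{0}) (σ : S' ⟶ S) (_ : IsIntegral S') (_ : IsDominant σ),
    IsRegularCentreBlowupSeq σ J ∧ IsLocallyPrincipal (J.comap σ) ∧
    ∀ s' : S', CleanRegAt p (algebraMap (S'.presheaf.stalk s') S'.functionField) (RatFn.functionFieldMap σ G)) :
    ∀ (p : ℕ), p.Prime → ∀ (k K : Type) [Field k] [CharP k p] [Field K] [Algebra k K] [Algebra.EssFiniteType k K],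
      Algebra.trdeg k K = 3 → ∀ (g₀ : K) (M₁ M₂ : ProjModel k K) (U₁ : M₁.X.Opens) (U₂ : M₂.X.Opens),
      (∀ x ∈ U₁, ModelCleanRegAt p g₀ M₁ x) → (∀ x ∈ U₂, ModelCleanRegAt p g₀ M₂ x) →
      ∃ (N : ProjModel k K) (φ₁ : N.Hom M₁) (φ₂ : N.Hom M₂),
        (∀ y : N.X, φ₁.f y ∈ U₁ → ModelCleanRegAt p g₀ N y) ∧ (∀ y : N.X, φ₂.f y ∈ U₂ → ModelCleanRegAt p g₀ N y) := by
  intro p hp k K _ _ _ _ _ htr g₀ M₁ M₂ U₁ U₂ h₁ h₂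
  exact cleanTwoModelPatching hT4 hp htr g₀ M₁ M₂ U₁ U₂ h₁ h₂

end Summit.ResolutionOfSingularities.ResolutionOfSingularities.Theorems.RadicialJung.CleanModels

end
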